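import Summits.Parity.BatemanHorn.Theorems.SoloInformedTrapezoidBlockProfile

/-!
# The trapezoid method: first-order phase variation and the block estimate with a long low-frequency range

Informed soloist `solo-Parity-informed` (session 144), conjunct `BatemanHorn`, the `d ≥ 3` rung BELOW the parity
wall.  The Abel coefficients `c_e(h) = K_e(h)/e` of the trapezoid form vary in the modulus through three pieces
(`trapCoef_succ_sub_eq`): the weight variation `K_N(Ψ_e)`, the phase variation `K_N(Φ_e(ξ^· − 1))`
(`ξ = e(h/(e(e+1)))`, `|ξ − 1| ≤ 2π|h|/(e(e+1))`) and `K_e(h)/(e(e+1))`.  `SoloInformedTrapezoidBlock` sums the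
phase piece by parts in `m` at SECOND order, which costs the second variation `V₂(Φ_e) ≍ 2 + D/(ΔA)` of the weights
— large for the moduli `e` near `X₁`, whose localisation ramp `a_e` is steep (`A ≍ e^{2/d} ≪ D`);
`SoloInformedTrapezoidCoefLow` does not sum by parts at all, which costs a factor `N|h|/e`.  Here the phase piece is
summed by parts at FIRST order: `V₁(Φ_e(ξ^· − 1)) ≤ |ξ − 1|·(N·V₁(Φ_e) + ∑|Φ_e|) ≤ |ξ − 1|·D(2N + N + 1)` and
`1/|1 − e(h/e)| ≤ e/(4|h|)` give the FREQUENCY-INDEPENDENT variation bound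
`|c_{e+1}(h) − c_e(h)| ≤ D·((N+1)(1 + 1/(2Δ) + π/2) + πN)/e²` (`0 < 2|h| ≤ e`; `norm_trapCoef_succ_sub_le_first`),
free of `V₂`.  With it the low-frequency range of the split block estimate can be taken as long as `|h| ≤ H₀` with
any `H₀ ≤ H` (`norm_trapBlockFirst_le`): the low part costs `(D/E)((N+1)(2 + 1/(2Δ) + π/2) + πN)·Λ₀`,
`Λ₀ ≥ ∑_{h≤H₀} (|T_t(h)| + |T_t(−h)|)`.  We also record the harmonic-weight lemma with an affine partial-sum bound
(`sum_Ioc_div_le_of_partial_sums_le_affine`): `∑_{h≤H'} x_h ≤ a + bH'` for all `H' ≤ H` gives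
`∑_{H₀<h≤H} x_h/h ≤ 2a/(H₀+1) + b(2 + log H)` — the constant part `a` is NOT charged the logarithm.
-/

namespace Summit.Parity.BatemanHorn.Theorems

open Finset Polynomial
open Literature.NumberTheory.Sieve (polyRootCountMod)

/-! ### First-order phase variation -/

/-- **`V₁(Φ_e(ξ^· − 1)) ≤ |ξ − 1|·(2D·N + D(N+1))`** (`N = X₀ + D + 2`, `|ξ| = 1`; vanishing of `a_e` on
`m ≤ A + 1`). [this work] -/
theorem sum_norm_bdiff_trapPhi_phase_le (g : ℤ[X]) {Δ : ℝ} (hΔ : 0 < Δ) (X₀ D : ℕ) {e : ℕ} (he : 1 ≤ e)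
    (hz : ∀ k : ℕ, g.eval (k : ℤ) ≠ 0) {m₀ A : ℕ} (hA : m₀ ≤ A)
    (hmono : ∀ m m' : ℕ, m₀ ≤ m → m ≤ m' → (g.eval (m : ℤ)).natAbs ≤ (g.eval (m' : ℤ)).natAbs)
    (hvan : ∀ m : ℕ, m ≤ A + 1 → locWeight g Δ e m = 0) {ξ : ℂ} (hξ : ‖ξ‖ = 1) :
    ∑ m ∈ range (X₀ + D + 2 + 1), ‖bdiff (fun k => trapPhi g Δ X₀ D e k * (ξ ^ k - 1)) m‖
      ≤ ‖ξ - 1‖ * (2 * D * ((X₀ + D + 2 : ℕ) : ℝ) + D * ((X₀ + D + 3 : ℕ) : ℝ)) := by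
  have hρ0 : 0 ≤ ‖ξ - 1‖ := norm_nonneg _
  have key := sum_norm_bdiff_mul_le (X₀ + D + 2) (trapPhi g Δ X₀ D e) (fun k => ξ ^ k - 1)
    (U₀ := ((X₀ + D + 2 : ℕ) : ℝ) * ‖ξ - 1‖) (U₁ := ‖ξ - 1‖) hρ0 ?_ ?_
  · refine key.trans ?_
    have hV₁ := sum_norm_bdiff_trapPhi_le g hΔ X₀ D he hz hA hmono hvan
    have hM := sum_norm_trapPhi_le g Δ X₀ D e
    have h1 : ((X₀ + D + 2 : ℕ) : ℝ) * ‖ξ - 1‖ * ∑ m ∈ range (X₀ + D + 2 + 1), ‖bdiff (trapPhi g Δ X₀ D e) m‖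
        ≤ ((X₀ + D + 2 : ℕ) : ℝ) * ‖ξ - 1‖ * (2 * D) := mul_le_mul_of_nonneg_left hV₁ (by positivity)
    have h2 : ‖ξ - 1‖ * ∑ m ∈ range (X₀ + D + 2 + 1), ‖trapPhi g Δ X₀ D e m‖
        ≤ ‖ξ - 1‖ * ((D : ℝ) * ((X₀ + D + 3 : ℕ) : ℝ)) := mul_le_mul_of_nonneg_left hM hρ0
    linarith
  · intro m hm
    have hmN : (m : ℝ) ≤ ((X₀ + D + 2 : ℕ) : ℝ) := by exact_mod_cast Nat.lt_succ_iff.mp (mem_range.mp hm)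
    calc ‖ξ ^ m - 1‖ ≤ m * ‖ξ - 1‖ := norm_pow_sub_one_le hξ m
      _ ≤ ((X₀ + D + 2 : ℕ) : ℝ) * ‖ξ - 1‖ := mul_le_mul_of_nonneg_right hmN hρ0
  · intro m _ hm
    exact (norm_bdiff_pow_sub_one hξ hm).le

/-- **First-order bound for the phase-variation kernel**:
`|K_N(Φ_e(ξ^· − 1); e(−h/e))| ≤ (π/2)·D·(2N + N + 1)/(e+1)` with `ξ = e(h/(e(e+1)))` (`0 < 2|h| ≤ e`). [this work] -/
theorem norm_trapKernelSum_phase_le_first (g : ℤ[X]) {Δ : ℝ} (hΔ : 0 < Δ) (X₀ D : ℕ) {e : ℕ} (he : 1 ≤ e)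
    (hz : ∀ k : ℕ, g.eval (k : ℤ) ≠ 0) {m₀ A : ℕ} (hA : m₀ ≤ A)
    (hmono : ∀ m m' : ℕ, m₀ ≤ m → m ≤ m' → (g.eval (m : ℤ)).natAbs ≤ (g.eval (m' : ℤ)).natAbs)
    (hvan : ∀ m : ℕ, m ≤ A + 1 → locWeight g Δ e m = 0) {h : ℤ} (h0 : h ≠ 0) (h2 : 2 * |h| ≤ (e : ℤ)) :
    ‖kernelSum (X₀ + D + 2) (fun m => trapPhi g Δ X₀ D e m * (eAdd (e * (e + 1)) h ^ m - 1)) (eAdd e (-h))‖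
      ≤ Real.pi / 2 * (2 * D * ((X₀ + D + 2 : ℕ) : ℝ) + D * ((X₀ + D + 3 : ℕ) : ℝ)) / ((e : ℝ) + 1) := by
  have he0 : e ≠ 0 := by omega
  have he' : (0 : ℝ) < e := by exact_mod_cast he
  have habs : (0 : ℝ) < |(h : ℝ)| := abs_pos.mpr (by exact_mod_cast h0)
  set ξ : ℂ := eAdd (e * (e + 1)) h with hξdef
  have hξ : ‖ξ‖ = 1 := norm_eAdd _ _
  have htop : (fun m => trapPhi g Δ X₀ D e m * (ξ ^ m - 1)) (X₀ + D + 2) = 0 := by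
    simp [(trapPhi_top g Δ X₀ D e).1]
  refine (norm_kernelSum_eAdd_le_first (X₀ + D + 2) htop h0 h2).trans ?_
  have hV := sum_norm_bdiff_trapPhi_phase_le g hΔ X₀ D he hz hA hmono hvan hξ
  have hρ := norm_eAdd_mul_succ_sub_one_le he0 h
  set M : ℝ := 2 * D * ((X₀ + D + 2 : ℕ) : ℝ) + D * ((X₀ + D + 3 : ℕ) : ℝ) with hM
  have hM0 : 0 ≤ M := by positivity
  calc (∑ m ∈ range (X₀ + D + 2 + 1), ‖bdiff (fun k => trapPhi g Δ X₀ D e k * (ξ ^ k - 1)) m‖)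
        * ((e : ℝ) / (4 * |(h : ℝ)|))
      ≤ (‖ξ - 1‖ * M) * ((e : ℝ) / (4 * |(h : ℝ)|)) := mul_le_mul_of_nonneg_right hV (by positivity)
    _ ≤ (2 * Real.pi * |(h : ℝ)| / ((e : ℝ) * ((e : ℝ) + 1)) * M) * ((e : ℝ) / (4 * |(h : ℝ)|)) :=
        mul_le_mul_of_nonneg_right (mul_le_mul_of_nonneg_right hρ hM0) (by positivity)
    _ = Real.pi / 2 * M / ((e : ℝ) + 1) := by
        field_simp
        ring

/-- Real arithmetic of the first-order coefficient variation. [this work] -/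
theorem coefFirst_variation_aux {a p q e : ℝ} (ha : 0 ≤ a) (hp : 0 ≤ p) (hq : 0 ≤ q) (he : 1 ≤ e) :
    (a / e + p / (e + 1)) / (e + 1) + q / (e * (e + 1)) ≤ (a + p + q) / e ^ 2 := by
  have he0 : 0 < e := by linarith
  have t1 : a / e / (e + 1) ≤ a / e ^ 2 := by
    rw [div_div]; exact div_le_div_of_nonneg_left ha (by positivity) (by nlinarith)
  have t2 : p / (e + 1) / (e + 1) ≤ p / e ^ 2 := by
    rw [div_div]; exact div_le_div_of_nonneg_left hp (by positivity) (by nlinarith)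
  have t3 : q / (e * (e + 1)) ≤ q / e ^ 2 := div_le_div_of_nonneg_left hq (by positivity) (by nlinarith)
  rw [add_div, add_div, add_div]
  linarith

/-- **`|c_{e+1}(h) − c_e(h)| ≤ D·((N+1)(1 + 1/(2Δ) + π/2) + πN)/e²`** (`N = X₀ + D + 2`, `0 < 2|h| ≤ e`, no integer
roots, vanishing of `a_e` on `m ≤ A + 1`): the FREQUENCY-INDEPENDENT bound for the variation of the Abel
coefficients — weight variation `D(N+1)/(2Δe)` (trivially), phase variation `(π/2)D(3N+1)/(e+1)` (first-order Abel
in `m`), and `|K_e(h)|/(e(e+1)) ≤ D(N+1)/(e(e+1))` (trivially). [this work] -/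
theorem norm_trapCoef_succ_sub_le_first (g : ℤ[X]) {Δ : ℝ} (hΔ : 0 < Δ) (X₀ D : ℕ) {e : ℕ} (he : 1 ≤ e)
    (hz : ∀ k : ℕ, g.eval (k : ℤ) ≠ 0) {m₀ A : ℕ} (hA : m₀ ≤ A)
    (hmono : ∀ m m' : ℕ, m₀ ≤ m → m ≤ m' → (g.eval (m : ℤ)).natAbs ≤ (g.eval (m' : ℤ)).natAbs)
    (hvan : ∀ m : ℕ, m ≤ A + 1 → locWeight g Δ e m = 0) {h : ℤ} (h0 : h ≠ 0) (h2 : 2 * |h| ≤ (e : ℤ)) :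
    ‖trapCoef g Δ X₀ D (e + 1) h - trapCoef g Δ X₀ D e h‖
      ≤ (D : ℝ) * (((X₀ + D + 3 : ℕ) : ℝ) * (1 + 1 / (2 * Δ) + Real.pi / 2) + Real.pi * ((X₀ + D + 2 : ℕ) : ℝ))
          / (e : ℝ) ^ 2 := by
  have he0 : e ≠ 0 := by omega
  have he' : (1 : ℝ) ≤ e := by exact_mod_cast he
  set N₁ : ℝ := ((X₀ + D + 3 : ℕ) : ℝ) with hN₁
  set N : ℝ := ((X₀ + D + 2 : ℕ) : ℝ) with hN
  have hN0 : 0 ≤ N := Nat.cast_nonneg _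
  have hN₁0 : 0 ≤ N₁ := Nat.cast_nonneg _
  -- the three kernel bounds
  have hΨ : ‖kernelSum (X₀ + D + 2) (trapPsi g Δ X₀ D e) (eAdd (e + 1) (-h))‖ ≤ (D : ℝ) * N₁ / (2 * Δ) / e := by
    rw [div_div]
    exact (norm_kernelSum_le _ _ (norm_eAdd _ _).le).trans (sum_norm_trapPsi_le g hΔ X₀ D he hz)
  have hφ := norm_trapKernelSum_phase_le_first g hΔ X₀ D he hz hA hmono hvan h0 h2
  have hK : ‖trapKs g Δ X₀ D e h‖ ≤ (D : ℝ) * N₁ := norm_trapKs_le g Δ X₀ D e h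
  -- assemble
  have hcast1 : ((e : ℂ) + 1) = ((e + 1 : ℕ) : ℂ) := by push_cast; ring
  rw [trapCoef_succ_sub_eq g Δ X₀ D he0 h]
  refine (norm_sub_le _ _).trans ?_
  rw [norm_div, norm_div, norm_mul, hcast1, Complex.norm_natCast, Complex.norm_natCast]
  push_cast
  refine (add_le_add (div_le_div_of_nonneg_right ((norm_add_le _ _).trans (add_le_add hΨ hφ)) (by positivity))
    (div_le_div_of_nonneg_right hK (by positivity))).trans ?_
  refine (coefFirst_variation_aux (a := (D : ℝ) * N₁ / (2 * Δ))
    (p := Real.pi / 2 * (2 * D * N + D * N₁)) (q := (D : ℝ) * N₁) (by positivity) (by positivity)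
    (by positivity) he').trans (le_of_eq ?_)
  ring

/-! ### The low-frequency main part with the frequency-independent bounds -/

/-- **The low-frequency main part of one sign, first-order form**: for `1 ≤ E ≤ E' ≤ 2E`, `2H₀ + 1 ≤ E`, the
vanishing of `a_e` on `m ≤ A + 1` (`e ≥ E`), and `Λ₀ ≥ ∑_{h≤H₀} |T_t(±h)|` (`E ≤ t ≤ E'`):
`∑_{h≤H₀} |∑_{E<e≤E'} c_e(±h)S_g(±h;e)| ≤ (D/E)·((N+1)(2 + 1/(2Δ) + π/2) + πN)·Λ₀` (`N = X₀ + D + 2`). [this work] -/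
theorem sum_norm_trapMainFirst_le (g : ℤ[X]) {Δ : ℝ} (hΔ : 0 < Δ) (X₀ D : ℕ)
    (hz : ∀ k : ℕ, g.eval (k : ℤ) ≠ 0) {m₀ A : ℕ} (hA : m₀ ≤ A)
    (hmono : ∀ m m' : ℕ, m₀ ≤ m → m ≤ m' → (g.eval (m : ℤ)).natAbs ≤ (g.eval (m' : ℤ)).natAbs)
    {E E' H₀ : ℕ} (hE : 1 ≤ E) (hEE' : E ≤ E') (hE'2 : E' ≤ 2 * E) (hH₀ : 2 * H₀ + 1 ≤ E)
    (hvan : ∀ e : ℕ, E ≤ e → ∀ m : ℕ, m ≤ A + 1 → locWeight g Δ e m = 0)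
    {Λ₀ : ℝ} (hΛ₀ : 0 ≤ Λ₀) (sgn : ℤ) (hsgn : sgn = 1 ∨ sgn = -1)
    (hT : ∀ t ∈ Icc E E', ∑ h ∈ Icc 1 H₀, ‖∑ i ∈ Ioc E t, hooleySum g i (sgn * h)‖ ≤ Λ₀) :
    ∑ h ∈ Icc 1 H₀, ‖∑ e ∈ Ioc E E', trapCoef g Δ X₀ D e (sgn * h) * hooleySum g e (sgn * h)‖
      ≤ (D : ℝ) / E * (((X₀ + D + 3 : ℕ) : ℝ) * (2 + 1 / (2 * Δ) + Real.pi / 2)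
          + Real.pi * ((X₀ + D + 2 : ℕ) : ℝ)) * Λ₀ := by
  have hE0 : (0 : ℝ) < E := by exact_mod_cast hE
  have habs : ∀ h : ℕ, |sgn * (h : ℤ)| = h := by intro h; rcases hsgn with rfl | rfl <;> simp
  set N₁ : ℝ := ((X₀ + D + 3 : ℕ) : ℝ) with hN₁
  set N : ℝ := ((X₀ + D + 2 : ℕ) : ℝ) with hN
  have hN0 : 0 ≤ N := Nat.cast_nonneg _
  have hN₁0 : 0 ≤ N₁ := Nat.cast_nonneg _
  have key := sum_norm_sum_Ioc_mul_le_of_const (fun e h => trapCoef g Δ X₀ D e (sgn * h))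
    (fun e h => hooleySum g e (sgn * h)) (Icc 1 H₀) hE hEE' hE'2 (B₀ := (D : ℝ) * N₁ / E)
    (W := (D : ℝ) * (N₁ * (1 + 1 / (2 * Δ) + Real.pi / 2) + Real.pi * N)) (L₀ := Λ₀) (by positivity)
    (by positivity) hΛ₀ ?_ ?_ hT
  · refine key.trans (le_of_eq ?_)
    field_simp
    ring
  · -- boundary coefficients
    intro h _
    have hE'1 : 1 ≤ E' := hE.trans hEE'
    refine (norm_trapCoef_le_low g Δ X₀ D hE'1 _).trans ?_
    exact div_le_div_of_nonneg_left (by positivity) hE0 (by exact_mod_cast hEE')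
  · -- variation
    intro e he h hh
    rw [mem_Ioo] at he
    rw [mem_Icc] at hh
    have hh0 : sgn * (h : ℤ) ≠ 0 := by rcases hsgn with rfl | rfl <;> simp <;> omega
    have hh2 : 2 * |sgn * (h : ℤ)| ≤ (e : ℤ) := by rw [habs]; exact_mod_cast (by omega : 2 * h ≤ e)
    exact norm_trapCoef_succ_sub_le_first g hΔ X₀ D (by omega) hz hA hmono (hvan e he.1.le) hh0 hh2

/-! ### Harmonic weights against an affine partial-sum bound -/

/-- `∑_{m ≤ j < n} 1/(j(j+1)) = 1/m − 1/n` (`1 ≤ m ≤ n`). [folklore] -/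
theorem sum_Ico_one_div_mul_succ {m n : ℕ} (hm : 1 ≤ m) (hmn : m ≤ n) :
    ∑ j ∈ Ico m n, 1 / ((j : ℝ) * ((j : ℝ) + 1)) = 1 / (m : ℝ) - 1 / (n : ℝ) := by
  induction n, hmn using Nat.le_induction with
  | base => simp
  | succ n hmn ih =>
    rw [sum_Ico_succ_top hmn, ih]
    have hn0 : (n : ℝ) ≠ 0 := by have : 1 ≤ n := hm.trans hmn; positivity
    push_cast
    field_simp
    ring

/-- **Harmonic weights against an affine partial-sum bound**: if `x ≥ 0` and `∑_{h≤H'} x_h ≤ a + b·H'` for all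
`1 ≤ H' ≤ H` (`a, b ≥ 0`), then `∑_{H₀<h≤H} x_h/h ≤ 2a/(H₀+1) + b·(2 + log H)`: the constant part `a` is charged
`1/(H₀+1)` twice and NO logarithm. [folklore] -/
theorem sum_Ioc_div_le_of_partial_sums_le_affine {x : ℕ → ℝ} (hx : ∀ h, 0 ≤ x h) {a b : ℝ} (ha : 0 ≤ a)
    (hb : 0 ≤ b) {H₀ H : ℕ} (hX : ∀ H' ∈ Icc 1 H, ∑ h ∈ Icc 1 H', x h ≤ a + b * H') :
    ∑ h ∈ Ioc H₀ H, x h / h ≤ 2 * a / ((H₀ : ℝ) + 1) + b * (2 + Real.log H) := by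
  have hlogH : 0 ≤ Real.log (H : ℝ) := Real.log_natCast_nonneg H
  rcases le_or_gt H H₀ with hle | hlt
  · rw [Ioc_eq_empty (by omega), sum_empty]; positivity
  have hH : 0 < H := by omega
  have hH' : (0 : ℝ) < H := by exact_mod_cast hH
  have hH₀1 : ((H₀ : ℝ) + 1) ≤ H := by exact_mod_cast hlt
  -- the truncated sequence
  set y : ℕ → ℝ := fun h => if H₀ < h then x h else 0 with hy
  have hy0 : ∀ h, 0 ≤ y h := fun h => by simp only [hy]; split_ifs <;> [exact hx h; exact le_rfl]
  have hsumy : ∀ j, ∑ h ∈ Icc 1 j, y h = ∑ h ∈ Ioc H₀ j, x h := by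
    intro j
    rw [hy, ← sum_filter]
    congr 1
    ext h
    simp only [mem_filter, mem_Icc, mem_Ioc]
    omega
  have hPy : ∀ j ∈ Icc 1 H, ∑ h ∈ Icc 1 j, y h ≤ if H₀ < j then a + b * j else 0 := by
    intro j hj
    rw [hsumy]
    split_ifs with hj'
    · rw [mem_Icc] at hj
      calc ∑ h ∈ Ioc H₀ j, x h ≤ ∑ h ∈ Icc 1 j, x h := by
            refine sum_le_sum_of_subset_of_nonneg (fun h hh => ?_) fun h _ _ => hx h
            rw [mem_Ioc] at hh; rw [mem_Icc]; omega
        _ ≤ a + b * j := hX j (mem_Icc.mpr hj)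
    · rw [Ioc_eq_empty (by omega), sum_empty]
  have hstart : ∑ h ∈ Ioc H₀ H, x h / h = ∑ h ∈ Icc 1 H, y h / h := by
    rw [hy]
    simp only [ite_div, zero_div]
    rw [← sum_filter]
    congr 1
    ext h
    simp only [mem_filter, mem_Icc, mem_Ioc]
    omega
  rw [hstart, RootMertens.sum_div_eq_abel]
  -- the boundary term
  have h1 : (∑ h ∈ Icc 1 H, y h) / H ≤ a / ((H₀ : ℝ) + 1) + b := by
    have := hPy H (mem_Icc.mpr ⟨hH, le_rfl⟩)
    rw [if_pos hlt] at this
    rw [div_le_iff₀ hH']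
    refine this.trans ?_
    have hq : a ≤ a * (H : ℝ) / ((H₀ : ℝ) + 1) := by
      rw [le_div_iff₀ (by positivity : (0 : ℝ) < (H₀ : ℝ) + 1)]
      exact mul_le_mul_of_nonneg_left hH₀1 ha
    rw [add_mul, div_mul_eq_mul_div]
    linarith
  -- the inner terms
  have h2 : ∑ j ∈ Ico 1 H, (∑ h ∈ Icc 1 j, y h) / ((j : ℝ) * ((j : ℝ) + 1))
      ≤ ∑ j ∈ Ico 1 H, (if H₀ < j then a * (1 / ((j : ℝ) * ((j : ℝ) + 1))) + b * (1 / ((j : ℝ) + 1)) else 0) := by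
    refine sum_le_sum fun j hj => ?_
    rw [mem_Ico] at hj
    have hj' : (0 : ℝ) < j := by exact_mod_cast hj.1
    have hPj := hPy j (mem_Icc.mpr ⟨hj.1, hj.2.le⟩)
    split_ifs at hPj ⊢ with hj''
    · rw [div_le_iff₀ (by positivity)]
      refine hPj.trans (le_of_eq ?_)
      field_simp
    · rw [div_le_iff₀ (by positivity)]
      simpa using hPj
  have h3 : ∑ j ∈ Ico 1 H, (if H₀ < j then a * (1 / ((j : ℝ) * ((j : ℝ) + 1))) + b * (1 / ((j : ℝ) + 1)) else 0)
      = a * ∑ j ∈ Ioo H₀ H, 1 / ((j : ℝ) * ((j : ℝ) + 1)) + b * ∑ j ∈ Ioo H₀ H, 1 / ((j : ℝ) + 1) := by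
    rw [← sum_filter, mul_sum, mul_sum, ← sum_add_distrib]
    congr 1
    ext j
    simp only [mem_filter, mem_Ico, mem_Ioo]
    omega
  have h4 : ∑ j ∈ Ioo H₀ H, 1 / ((j : ℝ) * ((j : ℝ) + 1)) ≤ 1 / ((H₀ : ℝ) + 1) := by
    rw [show Ioo H₀ H = Ico (H₀ + 1) H from by ext j; simp only [mem_Ioo, mem_Ico]; omega,
      sum_Ico_one_div_mul_succ (by omega) (by omega)]
    push_cast
    linarith [one_div_nonneg.mpr hH'.le]
  have h5 := sum_Ioo_one_div_succ_le H₀ H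
  rw [h3] at h2
  have h6 : a * ∑ j ∈ Ioo H₀ H, 1 / ((j : ℝ) * ((j : ℝ) + 1)) ≤ a * (1 / ((H₀ : ℝ) + 1)) :=
    mul_le_mul_of_nonneg_left h4 ha
  have h7 : b * ∑ j ∈ Ioo H₀ H, 1 / ((j : ℝ) + 1) ≤ b * (1 + Real.log H) := mul_le_mul_of_nonneg_left h5 hb
  have e8 : 2 * a / ((H₀ : ℝ) + 1) = a / ((H₀ : ℝ) + 1) + a * (1 / ((H₀ : ℝ) + 1)) := by ring
  rw [e8]
  linarith

/-! ### The block estimate with a long low-frequency range -/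

/-- **THE BLOCK ESTIMATE, FIRST-ORDER LOW RANGE.**  For `1 ≤ E ≤ E' ≤ 2E`, `H₀ ≤ H`, `2H + 1 ≤ E`, the vanishing
of `a_e` on `m ≤ A + 1` (`e ≥ E`), and majorants `Λ₀, Λ₁, Λ₂` as in `norm_trapBlockProfile_le`:
`‖Z(E,E']‖ ≤ 2·[(D/E)((N+1)(2 + 1/(2Δ) + π/2) + πN)·Λ₀ + (D/2 + W₁)·Λ₁ + W₂·Λ₂/E²] + V·E'²·R/(4(H+1))`. [this work] -/
theorem norm_trapBlockFirst_le (g : ℤ[X]) {Δ : ℝ} (hΔ : 0 < Δ) (X₀ D : ℕ)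
    (hz : ∀ k : ℕ, g.eval (k : ℤ) ≠ 0) {m₀ A : ℕ} (hA : m₀ ≤ A) (hA1 : 1 ≤ A)
    (hmono : ∀ m m' : ℕ, m₀ ≤ m → m ≤ m' → (g.eval (m : ℤ)).natAbs ≤ (g.eval (m' : ℤ)).natAbs)
    {C₁ C₂ : ℝ}
    (hC₁ : ∀ m : ℕ, 1 ≤ m →
      |Real.log ((g.eval ((m : ℤ) + 1)).natAbs : ℝ) - Real.log ((g.eval (m : ℤ)).natAbs : ℝ)| ≤ C₁ / m)
    (hC₂ : ∀ m : ℕ, 1 ≤ m →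
      |Real.log ((g.eval ((m : ℤ) + 2)).natAbs : ℝ) - 2 * Real.log ((g.eval ((m : ℤ) + 1)).natAbs : ℝ)
        + Real.log ((g.eval (m : ℤ)).natAbs : ℝ)| ≤ C₂ / (m : ℝ) ^ 2)
    {E E' H₀ H : ℕ} (hE : 1 ≤ E) (hEE' : E ≤ E') (hE'2 : E' ≤ 2 * E) (hH₀ : H₀ ≤ H) (hH : 2 * H + 1 ≤ E)
    (hvan : ∀ e : ℕ, E ≤ e → ∀ m : ℕ, m ≤ A + 1 → locWeight g Δ e m = 0)
    {Λ₀ Λ₁ Λ₂ : ℝ} (hΛ₀ : 0 ≤ Λ₀) (hΛ₁ : 0 ≤ Λ₁) (hΛ₂ : 0 ≤ Λ₂)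
    (hT₀ : ∀ t ∈ Icc E E', ∑ h ∈ Icc 1 H₀,
      (‖∑ i ∈ Ioc E t, hooleySum g i h‖ + ‖∑ i ∈ Ioc E t, hooleySum g i (-(h : ℤ))‖) ≤ Λ₀)
    (hT₁ : ∀ t ∈ Icc E E', ∑ h ∈ Ioc H₀ H,
      (‖∑ i ∈ Ioc E t, hooleySum g i h‖ + ‖∑ i ∈ Ioc E t, hooleySum g i (-(h : ℤ))‖) / h ≤ Λ₁)
    (hT₂ : ∀ t ∈ Icc E E', ∑ h ∈ Ioc H₀ H,
      (‖∑ i ∈ Ioc E t, hooleySum g i h‖ + ‖∑ i ∈ Ioc E t, hooleySum g i (-(h : ℤ))‖) ≤ Λ₂) :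
    ‖∑ e ∈ Ioc E E', 1 / (e : ℂ) * ∑ h ∈ Ico 1 e, trapKernel g Δ X₀ D e h * hooleySum g e h‖
      ≤ 2 * ((D : ℝ) / E * (((X₀ + D + 3 : ℕ) : ℝ) * (2 + 1 / (2 * Δ) + Real.pi / 2)
                + Real.pi * ((X₀ + D + 2 : ℕ) : ℝ)) * Λ₀
            + ((D : ℝ) / 2 + (((D : ℝ) / (2 * Δ) + Real.pi / 8 * (((X₀ + D + 2 : ℕ) : ℝ)
                * (2 + D * C₁ / (2 * Δ * ((X₀ : ℝ) + 1)) + D * ((C₂ + 4 * C₁) / (2 * Δ * A))) + 4 * D) + D / 2)))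
              * Λ₁
            + (Real.pi ^ 2 * D * ((X₀ + D + 3 : ℕ) : ℝ) / 4) * Λ₂ / (E : ℝ) ^ 2)
        + (2 + D * C₁ / (2 * Δ * ((X₀ : ℝ) + 1)) + D * ((C₂ + 4 * C₁) / (2 * Δ * A))) * (E' : ℝ) ^ 2
          * (∑ e ∈ Ioc E E', (polyRootCountMod ![g] e : ℝ) / e) / (4 * ((H : ℝ) + 1)) := by
  have hvan0 : ∀ e : ℕ, E < e → locWeight g Δ e 0 = 0 := fun e he => hvan e he.le 0 (by omega)
  have hH₀E : 2 * H₀ + 1 ≤ E := by omega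
  rw [trapBlock_eq g Δ X₀ D hH hvan0]
  -- one-sign hypotheses
  have hT₀' : ∀ sgn : ℤ, sgn = 1 ∨ sgn = -1 → ∀ t ∈ Icc E E',
      ∑ h ∈ Icc 1 H₀, ‖∑ i ∈ Ioc E t, hooleySum g i (sgn * h)‖ ≤ Λ₀ := fun sgn hsgn t ht =>
    (sum_le_sum fun h _ => norm_sgn_le (fun k => ∑ i ∈ Ioc E t, hooleySum g i k) sgn hsgn h).trans (hT₀ t ht)
  have hT₁' : ∀ sgn : ℤ, sgn = 1 ∨ sgn = -1 → ∀ t ∈ Icc E E',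
      ∑ h ∈ Ioc H₀ H, ‖∑ i ∈ Ioc E t, hooleySum g i (sgn * h)‖ / h ≤ Λ₁ := fun sgn hsgn t ht =>
    (sum_le_sum fun h _ => div_le_div_of_nonneg_right
      (norm_sgn_le (fun k => ∑ i ∈ Ioc E t, hooleySum g i k) sgn hsgn h) (Nat.cast_nonneg _)).trans (hT₁ t ht)
  have hT₂' : ∀ sgn : ℤ, sgn = 1 ∨ sgn = -1 → ∀ t ∈ Icc E E',
      ∑ h ∈ Ioc H₀ H, ‖∑ i ∈ Ioc E t, hooleySum g i (sgn * h)‖ ≤ Λ₂ := fun sgn hsgn t ht =>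
    (sum_le_sum fun h _ => norm_sgn_le (fun k => ∑ i ∈ Ioc E t, hooleySum g i k) sgn hsgn h).trans (hT₂ t ht)
  -- the four main pieces
  have hlowP := sum_norm_trapMainFirst_le g hΔ X₀ D hz hA hmono hE hEE' hE'2 hH₀E hvan hΛ₀ 1 (Or.inl rfl)
    (hT₀' 1 (Or.inl rfl))
  have hlowM := sum_norm_trapMainFirst_le g hΔ X₀ D hz hA hmono hE hEE' hE'2 hH₀E hvan hΛ₀ (-1) (Or.inr rfl)
    (hT₀' (-1) (Or.inr rfl))
  have hmidP := sum_norm_trapMainMid_le g hΔ X₀ D hz hA hA1 hmono hC₁ hC₂ hE hEE' hE'2 hH hvan hΛ₁ hΛ₂ 1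
    (Or.inl rfl) (hT₁' 1 (Or.inl rfl)) (hT₂' 1 (Or.inl rfl))
  have hmidM := sum_norm_trapMainMid_le g hΔ X₀ D hz hA hA1 hmono hC₁ hC₂ hE hEE' hE'2 hH hvan hΛ₁ hΛ₂ (-1)
    (Or.inr rfl) (hT₁' (-1) (Or.inr rfl)) (hT₂' (-1) (Or.inr rfl))
  simp only [one_mul] at hlowP hmidP
  simp only [neg_mul, one_mul] at hlowM hmidM
  have htail := norm_trapTail_le g hΔ X₀ D hz hA hA1 hmono hC₁ hC₂ (E' := E') (H := H) hE hvan
  -- split the main sums at `H₀`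
  have hmainP : ‖∑ h ∈ Icc 1 H, ∑ e ∈ Ioc E E', trapCoef g Δ X₀ D e h * hooleySum g e h‖
      ≤ ∑ h ∈ Icc 1 H₀, ‖∑ e ∈ Ioc E E', trapCoef g Δ X₀ D e h * hooleySum g e h‖
        + ∑ h ∈ Ioc H₀ H, ‖∑ e ∈ Ioc E E', trapCoef g Δ X₀ D e h * hooleySum g e h‖ := by
    rw [sum_Icc_one_eq_sum_Icc_add_sum_Ioc _ hH₀]
    exact (norm_add_le _ _).trans (add_le_add (norm_sum_le _ _) (norm_sum_le _ _))
  have hmainM : ‖∑ k ∈ Icc 1 H, ∑ e ∈ Ioc E E', trapCoef g Δ X₀ D e (-(k : ℤ)) * hooleySum g e (-(k : ℤ))‖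
      ≤ ∑ k ∈ Icc 1 H₀, ‖∑ e ∈ Ioc E E', trapCoef g Δ X₀ D e (-(k : ℤ)) * hooleySum g e (-(k : ℤ))‖
        + ∑ k ∈ Ioc H₀ H, ‖∑ e ∈ Ioc E E', trapCoef g Δ X₀ D e (-(k : ℤ)) * hooleySum g e (-(k : ℤ))‖ := by
    rw [sum_Icc_one_eq_sum_Icc_add_sum_Ioc _ hH₀]
    exact (norm_add_le _ _).trans (add_le_add (norm_sum_le _ _) (norm_sum_le _ _))
  refine (norm_add_le _ _).trans ?_
  refine (add_le_add ((norm_add_le _ _).trans (add_le_add hmainP hmainM)) htail).trans ?_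
  linarith

end Summit.Parity.BatemanHorn.Theorems
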